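import Literature.NumberTheory.Automorphic.ParabolicInduction
import Literature.NumberTheory.Automorphic.GLnCongruenceSubgroups
import Literature.NumberTheory.Automorphic.SmoothRepresentationIrreducibleContragredientProofs
import Literature.NumberTheory.Automorphic.JacquetLemma
import Literature.NumberTheory.Automorphic.CartanDecompositionGLnPowers
import HarnessLib

/-!
# Harish-Chandra's criterion for `GL_n(F)`: proof of the named fact `isSupercuspidal_iff_jacquetGL`

This sibling file of `Literature.NumberTheory.Automorphic.ParabolicInduction` discharges the named
fact `Literature.NumberTheory.Automorphic.isSupercuspidal_iff_jacquetGL` (**lang.S15** supplement;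
Harish-Chandra 1970; Casselman 1995, Thm. 5.3.1; Bernstein–Zelevinsky 1976, Thm. 3.21; Renard 2010,
VI.2.1; Bushnell–Henniart 2006, §10.1–10.2 for `n = 2`): an irreducible smooth complex
representation `π` of `GL_n(F)`, `F` a non-archimedean local field, is supercuspidal
(`Representation.IsSupercuspidal`: every smooth matrix coefficient has support in `C · Z(G)` with
`C` compact) if and only if all its proper Jacquet modules `V / V(U_c)`
(`Representation.restrictUnipotentGL F c π`, `c : Fin n → Fin r` monotone with `IsProperBlocks c`)
vanish — as `theorem isSupercuspidal_iff_jacquetGL_holds`. The file contains **theorems only** (no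
definitions, no instances, no named facts, no `sorry`). The group-theoretic input — principal
congruence subgroups `congruenceGL n γ`, unipotent balls `unipotentBallGL c γ` of a two-block
standard parabolic `P_c = M_c U_c`, their topology, torus conjugation and the Iwahori-type
factorisation `K_γ = (K_γ ∩ U_c)(K_γ ∩ P_c⁻)` — is `GLnCongruenceSubgroups` (`congruenceGL` is the
`ValuativeRel` counterpart of `valuedCongruenceSubgroup` of `GLnAdelicStructure`, which is phrased
for Mathlib `Valued` fields such as the completions `K_v`); the finite-averaging
technology (`Representation.sum_quotient_out_*`, open normal subgroups of compact groups fixing a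
vector, the projector onto `V^K`) is `SmoothRepresentationIrreducibleContragredientProofs`; finite
`GL_n(𝒪)`-orbits of smooth vectors come from `JacquetLemma`; the Cartan decomposition
`g = k₁⁻¹ ϖ^a k₂⁻¹` from `CartanDecompositionGLnPowers`. Haar measure is replaced throughout by
finite averages `Σ_{q ∈ K/L} π(q̃)` over the cosets of an open normal subgroup `L` of a compact group
`K` (the `Fintype` structures on these finite quotients are binders / local, never instances).

Both implications are proved for arbitrary **smooth** `π`; neither irreducibility nor
admissibility (lang.S16, Jacquet's theorem, which is *not* used) enters.

* `exists_pow_mul_le`, `exists_forall_lt_zpow_neg` — archimedean bookkeeping in the value group.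
* `exists_forall_sum_quotient_eq_zero_of_mem_ker` — **Jacquet's first lemma**, finite-average form:
  for `π` smooth and `v ∈ V(U_c)` the averages of `v` over all sufficiently large balls
  `U_c ∩ B_γ` modulo small open subgroups vanish ("`v ∈ V(N)` iff `∫_{N₀} π(n) v dn = 0` for some
  compact open `N₀ ≤ N`": Bernstein–Zelevinsky 1976, 2.33; Bushnell–Henniart 2006, §8.1).
* `exists_forall_apply_zpowDiagGL_eq_zero` — the **gap lemma**: for `φ ∈ Ṽ` and `v ∈ V(U_c)` there
  is `d` with `φ(π(ϖ^a) v) = 0` whenever `a_i - a_j ≥ d` across the cut (Casselman 1995, proof of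
  Thm. 5.3.1; Bernstein–Zelevinsky 1976, 3.18–3.21).
* `projector_eq_average`; the linear-algebra lemma `exists_dual_forall_exists_apply_pow_ne_zero`
  (for an injective endomorphism `T` and `w ≠ 0` some linear form sees `T^N w` for infinitely many
  `N`; it replaces the admissibility / eigen-quasi-character arguments of the printed proofs); cuts,
  the box lemma `le_mul_of_gaps_lt`, `coinvariantsKer_mono`.
* `isSupercuspidal_of_forall_coinvariantsKer_eq_top` (**⇐**): finite `GL_n(𝒪)`-orbits of `v` and
  `φ` and the gap lemma give a uniform `D` with `φ(π(k₁ ϖ^a k₂) v) = 0` as soon as one gap of the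
  antitone `a` across a two-block cut is `≥ D` (`exists_uniform_gap`); so on the support all
  consecutive gaps are `< D`, and after splitting off the central scalar `ϖ^{a_n}` the exponent lies
  in a finite box: `supp ⊆ (⋃_{a ∈ box} GL_n(𝒪) ϖ^a GL_n(𝒪)) · Z`.
* `coinvariantsKer_eq_top_of_isSupercuspidal` (**⇒**): if `v₀ ∉ V(U_c)` for a two-block `c`, take
  a principal congruence subgroup `K` fixing `v₀`, the projector `e` onto `V^K`, the torus elements
  `t_N = diag(ϖ^N · 1_{c = 0} + 1_{c = 1})`, the injective action `T` of `t_1` on `V / V(U_c)` and a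
  linear form `μ` with `μ(T^N [v₀]) ≠ 0` infinitely often; the smooth form `φ = μ ∘ [·] ∘ e` has
  `φ(π(t_N) v₀) = μ(T^N [v₀])` by the factorisation `K = (K ∩ U_c)(K ∩ P_c⁻)` and
  `t_N⁻¹ (K ∩ P_c⁻) t_N ⊆ K`, while `t_N ∉ C · Z` for large `N`
  (`exists_forall_zpowDiagGL_not_mem_mul_center`: `g ↦ (g⁻¹)_{i₀i₀} g_{j₀j₀}` is bounded on
  `C · Z` and equals `ϖ^{-N}` at `t_N`).
* a general proper standard parabolic is reduced to the maximal one containing it (first-block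
  coarsening, `unipotentRadicalGL_firstBlock_le`, `coinvariantsKer_mono`).

Relation to the printed source. Harish-Chandra (LNM 162) defines supercusp forms and supercuspidal
representations in Part I §3 and proves the two implications "`f_P = 0` for all `P ≠ G` ⇒ `f`
supercusp form" (Part IV, Theorem 8) and "compact support mod `Z` ⇒ supercusp form, i.e. all
`f^P = 0`" (Part IV, Lemma 15) for `𝒜(G, τ)` and *modulo his Conjecture III*; the unconditional
smooth-category statement for `GL_n` is Bernstein–Zelevinsky 1976, Thm. 3.21 / Casselman 1995,
Thm. 5.3.1. The present proof follows Casselman's mechanism (Iwahori factorisation, contraction of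
unipotent balls by the torus, Jacquet's first lemma) with integrals replaced by finite averages,
and Harish-Chandra's eigen-quasi-character argument (Lemmas 10, 15) replaced by the linear-algebra
lemma.

## References

* Harish-Chandra, *Harmonic analysis on reductive `p`-adic groups* (notes by G. van Dijk), Lecture
  Notes in Mathematics 162, Springer (1970), Part I §3; Part IV, Theorem 8, Lemmas 10–15, Theorem B
  (held copy `book:harish-chandrand-harmonic-analysis-reductive-p-adic-groups`, chunks 9, 24, 29–30).
  [HarishChandra1970]
* W. Casselman, *Introduction to the theory of admissible representations of `p`-adic reductive
  groups*, unpublished notes (draft 1995), §1.4, §3, Thm. 5.3.1.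
* I. N. Bernstein, A. V. Zelevinsky, *Representations of the group `GL(n, F)` where `F` is a
  non-archimedean local field*, Russian Math. Surveys 31:3 (1976), 1–68, 2.33, 3.18–3.21.
* D. Renard, *Représentations des groupes réductifs `p`-adiques*, Cours Spécialisés 17 (2010),
  VI.2.1.
* C. J. Bushnell, G. Henniart, *The local Langlands conjecture for `GL(2)`*, Grundlehren 335
  (2006), §§8.1, 10.1–10.2.
* D. Bump, *Automorphic Forms and Representations* (1997), §4.2 (the idempotents `ε_K`).
-/

noncomputable section

open scoped MatrixGroups Pointwise Topology
open ValuativeRel Matrix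

namespace Literature.NumberTheory.Automorphic


/-! ### Archimedean property of the value group -/

section Arch

variable {Γ : Type*} [LinearOrderedCommGroupWithZero Γ] [MulArchimedean Γ]

/-- For `0 < x < 1` in an archimedean value group, `x^d γ ≤ δ` for `d` large (`δ ≠ 0`).
[folklore] -/
theorem exists_pow_mul_le {x : Γ} (hx0 : x ≠ 0) (hx1 : x < 1) (γ : Γ) {δ : Γ} (hδ : δ ≠ 0) :
    ∃ d : ℕ, x ^ d * γ ≤ δ := by
  by_cases hγ : γ = 0
  · exact ⟨0, by simp [hγ]⟩
  have hx : 0 < x := zero_lt_iff.2 hx0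
  obtain ⟨d, hd⟩ := MulArchimedean.arch (γ * δ⁻¹) ((one_lt_inv₀ hx).2 hx1)
  refine ⟨d, ?_⟩
  rw [inv_pow] at hd
  have hxd : 0 < x ^ d := pow_pos hx d
  rw [mul_inv_le_iff₀ (zero_lt_iff.2 hδ)] at hd
  exact (le_inv_mul_iff₀ hxd).1 hd

/-- For `0 < x < 1` in an archimedean value group the powers `x^{-d}` are unbounded: for every
`γ` there is `d₀` with `γ < x^{-d}` for all `d ≥ d₀`. [folklore] -/
theorem exists_forall_lt_zpow_neg {x : Γ} (hx0 : x ≠ 0) (hx1 : x < 1) (γ : Γ) :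
    ∃ d₀ : ℕ, ∀ d : ℕ, d₀ ≤ d → γ < x ^ (-(d : ℤ)) := by
  by_cases hγ : γ = 0
  · refine ⟨0, fun d _ => ?_⟩
    rw [hγ]
    exact zero_lt_iff.2 (zpow_ne_zero _ hx0)
  have hx : 0 < x := zero_lt_iff.2 hx0
  obtain ⟨d₀, hd₀⟩ := exists_pow_mul_le hx0 hx1 γ (one_ne_zero (α := Γ))
  refine ⟨d₀ + 1, fun d hd => ?_⟩
  rw [_root_.zpow_neg, zpow_natCast]
  have hxd : 0 < x ^ d := pow_pos hx d
  have hlt : x ^ d * γ < 1 :=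
    calc x ^ d * γ ≤ x ^ (d₀ + 1) * γ := by
          exact mul_le_mul' (pow_le_pow_right_of_le_one' hx1.le hd) le_rfl
      _ = x * (x ^ d₀ * γ) := by rw [pow_succ', mul_assoc]
      _ < 1 := by
          calc x * (x ^ d₀ * γ) ≤ x * 1 := mul_le_mul' le_rfl hd₀
            _ = x := mul_one x
            _ < 1 := hx1
  calc γ = (x ^ d)⁻¹ * (x ^ d * γ) := by rw [← mul_assoc, inv_mul_cancel₀ hxd.ne', one_mul]
    _ < (x ^ d)⁻¹ * 1 := mul_lt_mul_of_pos_left hlt (inv_pos_of_pos hxd)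
    _ = (x ^ d)⁻¹ := mul_one _

end Arch

/-! ### Finite averages over unipotent balls; Jacquet's first lemma -/

section JacquetFirst

variable {F : Type*} [Field F] [ValuativeRel F] [TopologicalSpace F] [IsNonarchimedeanLocalField F]
  {n : ℕ} {c : Fin n → Fin 2} {k : Type*} [Field k] {V : Type*} [AddCommGroup V] [Module k V]
  (π : Representation k (GL (Fin n) F) V)

omit [ValuativeRel F] [TopologicalSpace F] [IsNonarchimedeanLocalField F] in
/-- The unipotent radical acts trivially on the Jacquet module: `[π u w] = [w]` for `u ∈ U_c`.
[folklore] -/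
theorem coinvariants_mk_apply_of_mem_unipotentRadicalGL {α : Type*} [LinearOrder α] [Fintype α]
    {c : Fin n → α} {u : GL (Fin n) F} (hu : u ∈ unipotentRadicalGL F c) (w : V) :
    Representation.Coinvariants.mk (Representation.restrictUnipotentGL F c π) (π u w) =
      Representation.Coinvariants.mk (Representation.restrictUnipotentGL F c π) w := by
  obtain ⟨p, hp, rfl⟩ := hu
  exact Representation.Coinvariants.mk_self_apply (Representation.restrictUnipotentGL F c π) ⟨p, hp⟩ w

omit [ValuativeRel F] [TopologicalSpace F] [IsNonarchimedeanLocalField F] in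
/-- `π u w - w` lies in the Jacquet kernel `V(U_c)` for `u ∈ U_c`. [folklore] -/
theorem apply_sub_mem_coinvariantsKer {α : Type*} [LinearOrder α] [Fintype α]
    {c : Fin n → α} {u : GL (Fin n) F} (hu : u ∈ unipotentRadicalGL F c) (w : V) :
    π u w - w ∈ Representation.Coinvariants.ker (Representation.restrictUnipotentGL F c π) := by
  rw [← Representation.Coinvariants.mk_eq_zero, map_sub, sub_eq_zero]
  exact coinvariants_mk_apply_of_mem_unipotentRadicalGL π hu w

/-- **Jacquet's first lemma for `GL_n(F)` (two-block parabolic), finite-average form.** If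
`π` is smooth and `v ∈ V(U_c) = ⟨π(u) w - w⟩`, then the finite averages of `v` over all
sufficiently large unipotent balls vanish: there is `γ₀` such that for every `γ ≥ γ₀` and every
sufficiently small open (normal) subgroup `L ≤ U_c ∩ B_γ`,
`Σ_{q ∈ (U_c ∩ B_γ)/L} π(q̃) v = 0`. (For a generator `π(u) w - w` with `u ∈ U_c ∩ B_γ` and `L`
fixing `w`, right multiplication by `u` permutes the cosets.) This is the Haar-measure-free form
of "`v ∈ V(N)` iff `∫_{N₀} π(n) v dn = 0` for some compact open `N₀ ≤ N`"
(Bernstein–Zelevinsky 1976, 2.33; Casselman 1995, §3; Bushnell–Henniart 2006, §8.1 Lemma). The quotients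
`(U_c ∩ B_γ)/L` are finite (`L` open in a compact group); the `Fintype` structure used to write the
average as a `Finset` sum is a binder of the statement (supply `Fintype.ofFinite _`). [folklore] -/
theorem exists_forall_sum_quotient_eq_zero_of_mem_ker (hπ : π.IsSmooth) {v : V}
    (hv : v ∈ Representation.Coinvariants.ker (Representation.restrictUnipotentGL F c π)) :
    ∃ γ₀ : ValueGroupWithZero F, ∀ γ, γ₀ ≤ γ →
      ∃ L₀ : OpenNormalSubgroup (unipotentBallGL c γ), ∀ L : OpenNormalSubgroup (unipotentBallGL c γ),
        L ≤ L₀ → ∀ [Fintype ((unipotentBallGL c γ) ⧸ L.toSubgroup)],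
          ∑ q : (unipotentBallGL c γ) ⧸ L.toSubgroup,
            π ((q.out : unipotentBallGL c γ) : GL (Fin n) F) v = 0 := by
  have hcs : ∀ γ : ValueGroupWithZero F, CompactSpace (unipotentBallGL c γ) := fun γ =>
    isCompact_iff_compactSpace.mp (isCompact_unipotentBallGL γ)
  induction hv using Submodule.span_induction with
  | mem x hx =>
    obtain ⟨⟨p, w⟩, rfl⟩ := hx
    have hu : ((p : standardParabolicGL F c) : GL (Fin n) F) ∈ unipotentRadicalGL F c :=
      ⟨p, p.2, rfl⟩
    obtain ⟨γ₀, hγ₀⟩ := exists_forall_mem_unipotentBallGL (c := c) (fun _ : Unit => ((p : standardParabolicGL F c) : GL (Fin n) F))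
      fun _ => hu
    refine ⟨γ₀, fun γ hγ => ?_⟩
    haveI := hcs γ
    obtain ⟨L₀, hL₀⟩ := hπ.exists_openNormalSubgroup_forall_apply_eq (unipotentBallGL c γ) w
    refine ⟨L₀, fun L hL _ => ?_⟩
    have hw : ∀ l ∈ L.toSubgroup, π ((l : unipotentBallGL c γ) : GL (Fin n) F) w = w :=
      fun l hl => hL₀ l (hL hl)
    have hmem : ((p : standardParabolicGL F c) : GL (Fin n) F) ∈ unipotentBallGL c γ :=
      unipotentBallGL_mono hγ (hγ₀ ())
    change ∑ q : (unipotentBallGL c γ) ⧸ L.toSubgroup, π ((q.out : unipotentBallGL c γ) : GL (Fin n) F)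
      (π ((p : standardParabolicGL F c) : GL (Fin n) F) w - w) = 0
    simp only [map_sub, Finset.sum_sub_distrib]
    rw [π.sum_quotient_out_apply_apply L.toSubgroup hw hmem, sub_self]
  | zero =>
    refine ⟨0, fun γ _ => ?_⟩
    haveI := hcs γ
    obtain ⟨L₀, -⟩ := hπ.exists_openNormalSubgroup_forall_apply_eq (unipotentBallGL c γ) (0 : V)
    exact ⟨L₀, fun L _ _ => by simp⟩
  | add x y hx hy ihx ihy =>
    obtain ⟨γ₁, h₁⟩ := ihx
    obtain ⟨γ₂, h₂⟩ := ihy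
    refine ⟨max γ₁ γ₂, fun γ hγ => ?_⟩
    obtain ⟨L₁, hL₁⟩ := h₁ γ (le_trans (le_max_left _ _) hγ)
    obtain ⟨L₂, hL₂⟩ := h₂ γ (le_trans (le_max_right _ _) hγ)
    refine ⟨L₁ ⊓ L₂, fun L hL _ => ?_⟩
    simp only [map_add, Finset.sum_add_distrib]
    rw [hL₁ L (hL.trans inf_le_left), hL₂ L (hL.trans inf_le_right), add_zero]
  | smul a x hx ihx =>
    obtain ⟨γ₁, h₁⟩ := ihx
    refine ⟨γ₁, fun γ hγ => ?_⟩
    obtain ⟨L₁, hL₁⟩ := h₁ γ hγ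
    refine ⟨L₁, fun L hL _ => ?_⟩
    simp only [map_smul, ← Finset.smul_sum]
    rw [hL₁ L hL, smul_zero]

end JacquetFirst

/-! ### The gap lemma: matrix coefficients vanish far from the walls -/

section Gap

variable {F : Type*} [Field F] [ValuativeRel F] [TopologicalSpace F] [IsNonarchimedeanLocalField F]
  {n : ℕ} {c : Fin n → Fin 2} {k : Type*} [Field k] [CharZero k] {V : Type*} [AddCommGroup V]
  [Module k V] (π : Representation k (GL (Fin n) F) V)

omit [CharZero k] in
/-- A smooth linear form is invariant under a small unipotent ball: `φ (π u x) = φ x` for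
`u ∈ U_c ∩ B_γ`, `γ` small. [folklore] -/
theorem exists_forall_apply_apply_eq_of_mem_contragredient {φ : Module.Dual k V}
    (hφ : φ ∈ π.contragredient) :
    ∃ γ : (ValueGroupWithZero F)ˣ, ∀ u ∈ unipotentBallGL c (γ : ValueGroupWithZero F), ∀ x : V,
      φ (π u x) = φ x := by
  have hopen : IsOpen ((π.dual.stabilizerSubgroup φ : Subgroup (GL (Fin n) F)) : Set (GL (Fin n) F)) := hφ
  obtain ⟨γ, hγ⟩ := exists_unipotentBallGL_subset (c := c)
    (hopen.mem_nhds (Subgroup.one_mem _))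
  refine ⟨γ, fun u hu x => ?_⟩
  have h := hγ (Subgroup.inv_mem _ hu)
  simp only [SetLike.mem_coe, Representation.mem_stabilizerSubgroup] at h
  have := LinearMap.congr_fun h x
  rw [Representation.dual_apply, inv_inv, Module.Dual.transpose_apply, LinearMap.comp_apply] at this
  exact this

omit [ValuativeRel F] [TopologicalSpace F] [IsNonarchimedeanLocalField F] in
/-- Diagonal torus elements lie in every standard parabolic. [folklore] -/
theorem zpowDiagGL_mem_standardParabolicGL {ϖ : F} (hϖ : ϖ ≠ 0) (a : Fin n → ℤ) {α : Type*}
    [LinearOrder α] (c : Fin n → α) : zpowDiagGL hϖ a ∈ standardParabolicGL F c := by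
  rw [mem_standardParabolicGL_iff, coe_zpowDiagGL]
  exact Matrix.blockTriangular_diagonal _

/-- **The gap lemma.** Let `π` be smooth, `φ ∈ Ṽ` a smooth linear form and `v ∈ V(U_c)` for a
two-block standard parabolic `P_c`. Then there is `d` such that `φ (π(ϖ^a) v) = 0` for every
`a ∈ ℤⁿ` whose gap across the cut is at least `d` (`a_i - a_j ≥ d` whenever `c i < c j`):
choose a ball `U_c ∩ B_{γ_r}` over which the averages of `v` vanish (Jacquet's first lemma) and a
ball `U_c ∩ B_{γ_s}` fixing `φ`; for such `a`, `ϖ^a (U_c ∩ B_{γ_r}) ϖ^{-a} ⊆ U_c ∩ B_{γ_s}`, so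
`|U_c ∩ B_{γ_r} / L| · φ(π(ϖ^a) v) = Σ_q φ(π(ϖ^a q̃ ϖ^{-a}) π(ϖ^a) v) = φ(π(ϖ^a) Σ_q π(q̃) v) = 0`.
(Casselman 1995, proof of Thm. 5.3.1; Bernstein–Zelevinsky 1976, 3.18–3.21;
Bushnell–Henniart 2006, §10.1 Proposition for `GL(2)`.) [folklore] -/
theorem exists_forall_apply_zpowDiagGL_eq_zero (hπ : π.IsSmooth) {ϖ : F}
    (hϖ : IsUniformizingElement ϖ) {φ : Module.Dual k V} (hφ : φ ∈ π.contragredient) {v : V}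
    (hv : v ∈ Representation.Coinvariants.ker (Representation.restrictUnipotentGL F c π)) :
    ∃ d : ℕ, ∀ a : Fin n → ℤ, (∀ i j, c i < c j → (d : ℤ) ≤ a i - a j) →
      φ (π (zpowDiagGL hϖ.ne_zero a) v) = 0 := by
  obtain ⟨γs, hγs⟩ := exists_forall_apply_apply_eq_of_mem_contragredient (c := c) π hφ
  obtain ⟨γ₀, hγ₀⟩ := exists_forall_sum_quotient_eq_zero_of_mem_ker π hπ hv
  obtain ⟨L₀, hL₀⟩ := hγ₀ γ₀ le_rfl
  haveI : CompactSpace (unipotentBallGL c γ₀) :=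
    isCompact_iff_compactSpace.mp (isCompact_unipotentBallGL γ₀)
  haveI : Fintype ((unipotentBallGL c γ₀) ⧸ L₀.toSubgroup) := Fintype.ofFinite _
  have hsum : ∑ q : (unipotentBallGL c γ₀) ⧸ L₀.toSubgroup,
      π ((q.out : unipotentBallGL c γ₀) : GL (Fin n) F) v = 0 := hL₀ L₀ le_rfl
  have hvϖ0 : valuation F ϖ ≠ 0 := (Valuation.ne_zero_iff _).2 hϖ.ne_zero
  obtain ⟨d, hd⟩ := exists_pow_mul_le hvϖ0 hϖ.valuation_lt_one γ₀ (Units.ne_zero γs)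
  refine ⟨d, fun a ha => ?_⟩
  set t : GL (Fin n) F := zpowDiagGL hϖ.ne_zero a with ht
  -- conjugation by `t` maps the ball of radius `γ₀` into the ball of radius `γs`
  have hconj : ∀ u ∈ unipotentBallGL c γ₀, t * u * t⁻¹ ∈ unipotentBallGL c (γs : ValueGroupWithZero F) := by
    intro u hu
    refine conj_mem_unipotentBallGL hϖ.ne_zero (fun i j hij => le_trans ?_ hd) hu
    refine mul_le_mul' ?_ le_rfl
    rw [← zpow_natCast]
    exact zpow_le_zpow_right_of_le_one₀ (zero_lt_iff.2 hvϖ0) hϖ.valuation_le_one (ha i j hij)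
  -- average the invariant quantity `φ (π t v)` over the finite quotient
  have hcard : (Fintype.card ((unipotentBallGL c γ₀) ⧸ L₀.toSubgroup) : k) ≠ 0 :=
    Nat.cast_ne_zero.2 Fintype.card_ne_zero
  have key : ∀ q : (unipotentBallGL c γ₀) ⧸ L₀.toSubgroup,
      φ (π t v) = φ (π t (π ((q.out : unipotentBallGL c γ₀) : GL (Fin n) F) v)) := by
    intro q
    rw [← hγs _ (hconj _ (q.out).2) (π t v), ← Module.End.mul_apply, ← map_mul,
      ← Module.End.mul_apply, ← map_mul, inv_mul_cancel_right]
  have : (Fintype.card ((unipotentBallGL c γ₀) ⧸ L₀.toSubgroup) : k) * φ (π t v) = 0 := by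
    rw [← nsmul_eq_mul, ← Finset.card_univ, ← Finset.sum_const]
    rw [Finset.sum_congr rfl fun q _ => key q, ← map_sum, ← map_sum, hsum, map_zero, map_zero]
  exact (mul_eq_zero.1 this).resolve_left hcard

end Gap

/-! ### The projector onto `K`-fixed vectors as a finite average -/

section Projector

variable {k G V : Type*} [Field k] [CharZero k] [Group G] [AddCommGroup V] [Module k V]
  (ρ : Representation k G V)

/-- A `K`-invariant projector onto `V^K` is the normalised finite average over `K/L` for any
normal subgroup `L ≤ K` of finite index fixing the vector (the projector `π(e_K)` of
Bump 1997, §4.2 / Casselman 1995, §2.1, in the Haar-free form of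
`Representation.IsSmooth.exists_fixedPoints_projection`). [folklore] -/
theorem projector_eq_average {K : Subgroup G} (e : V →ₗ[k] V)
    (he₂ : ∀ v ∈ ρ.fixedPoints K, e v = v) (he₃ : ∀ g ∈ K, ∀ v, e (ρ g v) = e v)
    (L : Subgroup K) [L.Normal] [Fintype (K ⧸ L)] {x : V} (hx : ∀ l ∈ L, ρ ((l : K) : G) x = x) :
    e x = (Fintype.card (K ⧸ L) : k)⁻¹ • ∑ r : K ⧸ L, ρ ((r.out : K) : G) x := by
  have hfix := ρ.sum_quotient_out_apply_mem_fixedPoints L hx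
  have h1 : e (∑ r : K ⧸ L, ρ ((r.out : K) : G) x) = ∑ r : K ⧸ L, ρ ((r.out : K) : G) x :=
    he₂ _ hfix
  have h2 : e (∑ r : K ⧸ L, ρ ((r.out : K) : G) x) = (Fintype.card (K ⧸ L) : k) • e x := by
    rw [map_sum, Finset.sum_congr rfl fun r _ => he₃ _ (r.out).2 x, Finset.sum_const,
      Finset.card_univ, Nat.cast_smul_eq_nsmul]
  rw [← h1, h2, smul_smul, inv_mul_cancel₀ (Nat.cast_ne_zero.2 Fintype.card_ne_zero), one_smul]

end Projector

/-! ### A linear-algebra lemma: iterates of an injective operator seen by one linear form -/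

section LinearAlgebra

variable {k W : Type*} [Field k] [AddCommGroup W] [Module k W]

/-- **Iterates of an injective endomorphism are detected infinitely often by a single linear
form.** If `T : W → W` is injective and `w ≠ 0`, there is `μ ∈ W^*` with `μ (T^N w) ≠ 0` for
infinitely many `N`. If the iterates `T^N w` are linearly independent, take `μ = 1` on all of
them; otherwise they span a finite-dimensional `T`-stable subspace `W₀ ∋ w`, and any `μ` with
`μ w ≠ 0` works: were `μ (T^N w) = 0` for all `N ≥ N₀`, the subspace
`Y = {x ∈ W₀ | μ (T^N x) = 0 ∀ N ≥ N₀} ∋ w` would be `T`-stable, hence `T Y = Y` (`T` injective,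
`Y` finite-dimensional), so `w = T^{N₀} y` with `y ∈ Y` and `μ w = 0`. [folklore] -/
theorem exists_dual_forall_exists_apply_pow_ne_zero (T : W →ₗ[k] W) (hT : Function.Injective T)
    {w : W} (hw : w ≠ 0) :
    ∃ μ : Module.Dual k W, ∀ N₀ : ℕ, ∃ N, N₀ ≤ N ∧ μ ((T ^ N) w) ≠ 0 := by
  classical
  set f : ℕ → W := fun N => (T ^ N) w with hf
  have hf_succ : ∀ N, T (f N) = f (N + 1) := fun N => by
    simp only [hf, pow_succ', Module.End.mul_apply]
  by_cases hli : LinearIndependent k f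
  · -- all iterates independent: `μ = 1` on each of them
    set μ₀ : Submodule.span k (Set.range f) →ₗ[k] k :=
      (Finsupp.linearCombination k fun _ : ℕ => (1 : k)) ∘ₗ hli.repr with hμ₀
    obtain ⟨μ, hμ⟩ := LinearMap.exists_extend μ₀
    refine ⟨μ, fun N₀ => ⟨N₀, le_rfl, ?_⟩⟩
    have : μ (f N₀) = 1 := by
      have h := LinearMap.congr_fun hμ ⟨f N₀, Submodule.subset_span ⟨N₀, rfl⟩⟩
      rw [LinearMap.comp_apply, Submodule.subtype_apply] at h
      rw [h, hμ₀, LinearMap.comp_apply, hli.repr_eq_single N₀ _ rfl, Finsupp.linearCombination_single,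
        smul_eq_mul, mul_one]
    rw [this]
    exact one_ne_zero
  · -- a dependency: the iterates span a finite-dimensional `T`-stable subspace containing `w`
    obtain ⟨s, g, hsum, i, hi, hgi⟩ := not_linearIndependent_iff.1 hli
    set s' : Finset ℕ := s.filter fun N => g N ≠ 0 with hs'
    have hs'ne : s'.Nonempty := ⟨i, Finset.mem_filter.2 ⟨hi, hgi⟩⟩
    set M : ℕ := s'.max' hs'ne with hM
    have hMs' : M ∈ s' := Finset.max'_mem _ _
    have hgM : g M ≠ 0 := (Finset.mem_filter.1 hMs').2
    have hMs : M ∈ s := (Finset.mem_filter.1 hMs').1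
    set W₀ : Submodule k W := Submodule.span k (f '' Set.Iio M) with hW₀
    -- `f M ∈ W₀`
    have hfM : f M ∈ W₀ := by
      have hsplit : g M • f M + ∑ N ∈ s.erase M, g N • f N = 0 := by
        rw [Finset.add_sum_erase s (fun N => g N • f N) hMs]
        exact hsum
      have hrest : ∑ N ∈ s.erase M, g N • f N ∈ W₀ := by
        refine Submodule.sum_mem _ fun N hN => ?_
        by_cases hgN : g N = 0
        · rw [hgN, zero_smul]; exact Submodule.zero_mem _
        · refine Submodule.smul_mem _ _ (Submodule.subset_span ⟨N, ?_, rfl⟩)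
          have hNs' : N ∈ s' := Finset.mem_filter.2 ⟨Finset.mem_of_mem_erase hN, hgN⟩
          exact lt_of_le_of_ne (Finset.le_max' _ _ hNs') (Finset.ne_of_mem_erase hN)
      have : g M • f M = -∑ N ∈ s.erase M, g N • f N := eq_neg_of_add_eq_zero_left hsplit
      have h2 : g M • f M ∈ W₀ := by rw [this]; exact Submodule.neg_mem _ hrest
      exact (Submodule.smul_mem_iff _ hgM).1 h2
    -- all iterates lie in `W₀`
    have hstable : ∀ x ∈ W₀, T x ∈ W₀ := by
      intro x hx
      refine Submodule.span_induction (p := fun x _ => T x ∈ W₀) ?_ (by simp) (fun x y _ _ hx hy => ?_)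
        (fun a x _ hx => ?_) hx
      · rintro _ ⟨N, hN, rfl⟩
        rw [hf_succ]
        rcases lt_or_eq_of_le (Nat.succ_le_of_lt hN) with h | h
        · exact Submodule.subset_span ⟨N + 1, h, rfl⟩
        · rw [show N + 1 = M from h]; exact hfM
      · rw [map_add]; exact Submodule.add_mem _ hx hy
      · rw [map_smul]; exact Submodule.smul_mem _ _ hx
    have hw₀ : w ∈ W₀ := by
      rcases Nat.eq_zero_or_pos M with h | h
      · have : f M = w := by rw [h]; simp [hf]
        rw [← this]; exact hfM
      · exact Submodule.subset_span ⟨0, h, by simp [hf]⟩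
    haveI : FiniteDimensional k W₀ :=
      FiniteDimensional.span_of_finite k ((Set.finite_Iio M).image f)
    -- any `μ` with `μ w ≠ 0` works
    obtain ⟨μ, hμ⟩ := Module.Projective.exists_dual_ne_zero k hw
    refine ⟨μ, fun N₀ => ?_⟩
    by_contra hcon'
    have hcon : ∀ N, N₀ ≤ N → μ ((T ^ N) w) = 0 := fun N hN => by
      by_contra h'
      exact hcon' ⟨N, hN, h'⟩
    -- `Y = {x ∈ W₀ | μ (T^N x) = 0 for all N ≥ N₀}`
    set Y : Submodule k W :=
      { carrier := {x | x ∈ W₀ ∧ ∀ N, N₀ ≤ N → μ ((T ^ N) x) = 0}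
        add_mem' := fun {x y} hx hy => ⟨Submodule.add_mem _ hx.1 hy.1, fun N hN => by
          rw [map_add, map_add, hx.2 N hN, hy.2 N hN, add_zero]⟩
        zero_mem' := ⟨Submodule.zero_mem _, fun N _ => by simp⟩
        smul_mem' := fun a x hx => ⟨Submodule.smul_mem _ _ hx.1, fun N hN => by
          rw [map_smul, map_smul, hx.2 N hN, smul_zero]⟩ } with hY
    have hwY : w ∈ Y := ⟨hw₀, fun N hN => hcon N hN⟩
    have hYW₀ : Y ≤ W₀ := fun x hx => hx.1
    have hTY : ∀ x ∈ Y, T x ∈ Y := fun x hx => ⟨hstable x hx.1, fun N hN => by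
      rw [← Module.End.mul_apply, ← pow_succ]
      exact hx.2 (N + 1) (Nat.le_succ_of_le hN)⟩
    haveI : FiniteDimensional k Y := Submodule.finiteDimensional_of_le hYW₀
    set TY : Y →ₗ[k] Y := T.restrict fun x hx => hTY x hx with hTYdef
    have hTYinj : Function.Injective TY := by
      intro x y hxy
      apply Subtype.ext
      apply hT
      have := congrArg Subtype.val hxy
      simpa [hTYdef, LinearMap.restrict_apply] using this
    have hTYsurj : Function.Surjective TY := LinearMap.injective_iff_surjective.1 hTYinj
    have hiter : ∀ m : ℕ, ∃ y : Y, (T ^ m) (y : W) = w := by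
      intro m
      induction m with
      | zero => exact ⟨⟨w, hwY⟩, by simp⟩
      | succ m ih =>
        obtain ⟨y, hy⟩ := ih
        obtain ⟨y', hy'⟩ := hTYsurj y
        refine ⟨y', ?_⟩
        have : T (y' : W) = y := by
          have := congrArg Subtype.val hy'
          simpa [hTYdef, LinearMap.restrict_apply] using this
        rw [pow_succ, Module.End.mul_apply, this, hy]
    obtain ⟨y, hy⟩ := hiter N₀
    apply hμ
    rw [← hy]
    exact y.2.2 N₀ le_rfl

end LinearAlgebra

/-! ### Two-block cuts and the box lemma -/

section Cuts

/-- The **two-block cut after position `i`** — the labelling `j ↦ 0` for `j ≤ i`, `j ↦ 1` for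
`j > i` of `Fin (N + 1)` — is monotone. [folklore] -/
theorem cutAfter_monotone {N : ℕ} (i : Fin N) :
    Monotone (fun j : Fin (N + 1) => if j ≤ Fin.castSucc i then (0 : Fin 2) else 1) := by
  intro j j' hjj'
  show (if j ≤ Fin.castSucc i then (0 : Fin 2) else 1) ≤ (if j' ≤ Fin.castSucc i then (0 : Fin 2) else 1)
  by_cases h : j' ≤ Fin.castSucc i
  · rw [if_pos (hjj'.trans h), if_pos h]
  · rw [if_neg h]
    split_ifs <;> decide

/-- The two-block cut after `i` is a proper block labelling (both labels occur). [folklore] -/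
theorem isProperBlocks_cutAfter {N : ℕ} (i : Fin N) :
    IsProperBlocks (fun j : Fin (N + 1) => if j ≤ Fin.castSucc i then (0 : Fin 2) else 1) := by
  refine ⟨fun x => ?_, inferInstance⟩
  rcases Fin.exists_fin_two.1 ⟨x, rfl⟩ with rfl | rfl
  · exact ⟨Fin.castSucc i, by simp⟩
  · exact ⟨i.succ, by simp⟩

/-- Across the cut after `i`, an antitone exponent vector has gap at least `a_i - a_{i+1}`.
[folklore] -/
theorem sub_le_sub_of_cutAfter_lt {N : ℕ} (i : Fin N) {a : Fin (N + 1) → ℤ} (ha : Antitone a)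
    {j j' : Fin (N + 1)}
    (h : (if j ≤ Fin.castSucc i then (0 : Fin 2) else 1) < (if j' ≤ Fin.castSucc i then (0 : Fin 2) else 1)) :
    a (Fin.castSucc i) - a i.succ ≤ a j - a j' := by
  by_cases hj : j ≤ Fin.castSucc i <;> by_cases hj' : j' ≤ Fin.castSucc i <;>
    simp only [hj, hj', if_true, if_false, lt_self_iff_false] at h
  · have h1 : a (Fin.castSucc i) ≤ a j := ha hj
    have h2 : a j' ≤ a i.succ := ha (Fin.castSucc_lt_iff_succ_le.1 (not_le.1 hj'))
    linarith
  · exact absurd h (by decide)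

/-- **Box lemma.** If `a ∈ ℤ^{N+1}` has `a_N = 0` and all consecutive gaps `a_i - a_{i+1} < D`,
then `a_i ≤ (N - i) D`. [folklore] -/
theorem le_mul_of_gaps_lt {N D : ℕ} {a : Fin (N + 1) → ℤ} (h0 : a (Fin.last N) = 0)
    (hg : ∀ i : Fin N, a (Fin.castSucc i) - a i.succ < D) (i : Fin (N + 1)) :
    a i ≤ ((N : ℤ) - i) * D := by
  induction i using Fin.reverseInduction with
  | last => simp [h0]
  | cast i ih =>
    have h1 := hg i
    have h2 : ((N : ℤ) - (Fin.castSucc i : ℕ)) * D = ((N : ℤ) - (i.succ : ℕ)) * D + D := by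
      simp only [Fin.val_castSucc, Fin.val_succ]
      push_cast
      ring
    rw [h2]
    linarith

end Cuts

/-! ### Reduction to two-block labellings -/

section Reduction

variable {F : Type*} [Field F] {n : ℕ}

/-- The **first-block coarsening** `i ↦ 0` if `c i` is the first label, `i ↦ 1` otherwise, of a
monotone labelling `c : Fin n → Fin r` is monotone (it is the two-block labelling of the maximal
standard parabolic containing `P_c`). [folklore] -/
theorem firstBlock_monotone {r : ℕ} {c : Fin n → Fin r} (hc : Monotone c) :
    Monotone (fun i => if ((c i : Fin r) : ℕ) = 0 then (0 : Fin 2) else 1) := by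
  intro i j hij
  show (if ((c i : Fin r) : ℕ) = 0 then (0 : Fin 2) else 1) ≤ (if ((c j : Fin r) : ℕ) = 0 then (0 : Fin 2) else 1)
  by_cases hj : (c j : ℕ) = 0
  · have hi : (c i : ℕ) = 0 := by
      have := hc hij
      rw [Fin.le_def] at this
      omega
    rw [if_pos hi, if_pos hj]
  · rw [if_neg hj]
    split_ifs <;> decide

/-- The first-block coarsening of a proper labelling is proper. [folklore] -/
theorem isProperBlocks_firstBlock {r : ℕ} {c : Fin n → Fin r} (hc : IsProperBlocks c) :
    IsProperBlocks (fun i => if ((c i : Fin r) : ℕ) = 0 then (0 : Fin 2) else 1) := by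
  have hr : 2 ≤ r := ((isProperBlocks_iff_two_le c).1 hc).2
  refine ⟨fun x => ?_, inferInstance⟩
  rcases Fin.exists_fin_two.1 ⟨x, rfl⟩ with rfl | rfl
  · obtain ⟨i, hi⟩ := hc.1 ⟨0, by omega⟩
    exact ⟨i, by simp [hi]⟩
  · obtain ⟨j, hj⟩ := hc.1 ⟨1, by omega⟩
    exact ⟨j, by simp [hj]⟩

/-- The unipotent radical of the first-block coarsening is contained in the original one
(`U_{c'} ≤ U_c` for `P_c ≤ P_{c'}`). [folklore] -/
theorem unipotentRadicalGL_firstBlock_le {r : ℕ} (c : Fin n → Fin r) :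
    unipotentRadicalGL F (fun i => if ((c i : Fin r) : ℕ) = 0 then (0 : Fin 2) else 1) ≤ unipotentRadicalGL F c := by
  intro g hg
  rw [mem_unipotentRadicalGL_iff_apply] at hg ⊢
  intro i j hij
  refine hg i j ?_
  show (if ((c j : Fin r) : ℕ) = 0 then (0 : Fin 2) else 1) ≤ (if ((c i : Fin r) : ℕ) = 0 then (0 : Fin 2) else 1)
  by_cases hi : (c i : ℕ) = 0
  · have hj : (c j : ℕ) = 0 := by rw [Fin.le_def] at hij; omega
    rw [if_pos hi, if_pos hj]
  · rw [if_neg hi]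
    split_ifs <;> decide

variable {k : Type*} [CommRing k] {V : Type*} [AddCommGroup V] [Module k V]
  (π : Representation k (GL (Fin n) F) V)

/-- The Jacquet kernel is monotone in the unipotent radical: `U_{c'} ≤ U_c` implies
`V(U_{c'}) ≤ V(U_c)`. [folklore] -/
theorem coinvariantsKer_mono {α β : Type*} [LinearOrder α] [Fintype α] [LinearOrder β] [Fintype β]
    {c : Fin n → α} {c' : Fin n → β} (h : unipotentRadicalGL F c' ≤ unipotentRadicalGL F c) :
    Representation.Coinvariants.ker (Representation.restrictUnipotentGL F c' π) ≤
      Representation.Coinvariants.ker (Representation.restrictUnipotentGL F c π) := by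
  refine Submodule.span_le.2 ?_
  rintro _ ⟨⟨p, w⟩, rfl⟩
  have hu : ((p : standardParabolicGL F c') : GL (Fin n) F) ∈ unipotentRadicalGL F c := h ⟨p, p.2, rfl⟩
  obtain ⟨p', hp', hp'eq⟩ := hu
  have hp'eq' : ((p' : standardParabolicGL F c) : GL (Fin n) F) =
      ((p : standardParabolicGL F c') : GL (Fin n) F) := hp'eq
  have : (Representation.restrictUnipotentGL F c' π) p w =
      (Representation.restrictUnipotentGL F c π) ⟨p', hp'⟩ w := by
    change π ((p : standardParabolicGL F c') : GL (Fin n) F) w =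
      π ((p' : standardParabolicGL F c) : GL (Fin n) F) w
    rw [hp'eq']
  change (Representation.restrictUnipotentGL F c' π) p w - w ∈ _
  rw [this]
  exact Representation.Coinvariants.sub_mem_ker _ _

end Reduction


section Unbounded

variable {F : Type*} [Field F] [ValuativeRel F] [TopologicalSpace F] [IsNonarchimedeanLocalField F]
  {n : ℕ}

/-- A compact subset of a non-archimedean local field is bounded in valuation. [folklore] -/
theorem exists_forall_valuation_le_of_isCompact {S : Set F} (hS : IsCompact S) :
    ∃ γ : ValueGroupWithZero F, ∀ x ∈ S, valuation F x ≤ γ := by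
  have hcover : S ⊆ ⋃ γ : (ValueGroupWithZero F)ˣ, {x : F | valuation F x ≤ γ} := by
    intro x _
    by_cases hx : valuation F x = 0
    · exact Set.mem_iUnion.2 ⟨1, by simp [hx]⟩
    · exact Set.mem_iUnion.2 ⟨Units.mk0 _ hx, by simp⟩
  obtain ⟨s, hs⟩ := hS.elim_finite_subcover _
    (fun γ => DeltaCharBorel.isOpen_setOf_valuation_le (Units.ne_zero γ))
    hcover
  refine ⟨s.sup fun γ => (γ : ValueGroupWithZero F), fun x hx => ?_⟩
  obtain ⟨γ, hγs, hxγ⟩ := Set.mem_iUnion₂.1 (hs hx)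
  exact le_trans hxγ (Finset.le_sup (f := fun γ : (ValueGroupWithZero F)ˣ =>
    (γ : ValueGroupWithZero F)) hγs)

/-- **The torus elements `ϖ^{N · 1_S}` eventually leave `C · Z(G)`** for every compact `C`: the
continuous function `g ↦ (g⁻¹)_{i₀ i₀} g_{j₀ j₀}` (`i₀` in the block `c = 0`, `j₀` in the block
`c = 1`) is invariant under the centre (scalar matrices), bounded in valuation on `C`, and takes
the value `ϖ^{-N}` at `ϖ^{N · 1_S}`. [folklore] -/
theorem exists_forall_zpowDiagGL_not_mem_mul_center {ϖ : F} (hϖ : IsUniformizingElement ϖ)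
    {c : Fin n → Fin 2} {i₀ j₀ : Fin n} (hi₀ : c i₀ = 0) (hj₀ : c j₀ = 1)
    {C : Set (GL (Fin n) F)} (hC : IsCompact C) :
    ∃ N₀ : ℕ, ∀ N : ℕ, N₀ ≤ N →
      zpowDiagGL hϖ.ne_zero (fun i => if c i = 0 then (N : ℤ) else 0) ∉
        C * (Subgroup.center (GL (Fin n) F) : Set (GL (Fin n) F)) := by
  set f : GL (Fin n) F → F := fun g =>
    ((g⁻¹ : GL (Fin n) F) : Matrix (Fin n) (Fin n) F) i₀ i₀ * (g : Matrix (Fin n) (Fin n) F) j₀ j₀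
    with hfdef
  have hf : Continuous f :=
    (Units.continuous_coe_inv.matrix_elem i₀ i₀).mul (Units.continuous_val.matrix_elem j₀ j₀)
  obtain ⟨γ, hγ⟩ := exists_forall_valuation_le_of_isCompact (hC.image hf)
  have hvϖ0 : valuation F ϖ ≠ 0 := (Valuation.ne_zero_iff _).2 hϖ.ne_zero
  obtain ⟨N₀, hN₀⟩ := exists_forall_lt_zpow_neg hvϖ0 hϖ.valuation_lt_one γ
  refine ⟨N₀, fun N hN hmem => ?_⟩
  obtain ⟨g, hg, z, hz, hgz⟩ := Set.mem_mul.1 hmem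
  rw [SetLike.mem_coe, Matrix.GeneralLinearGroup.center_eq_range_scalar] at hz
  obtain ⟨u, rfl⟩ := hz
  -- `f` is invariant under the centre
  have hfz : f (g * Matrix.GeneralLinearGroup.scalar (Fin n) u) = f g := by
    simp only [hfdef, _root_.mul_inv_rev, Units.val_mul, ← map_inv, Matrix.GeneralLinearGroup.coe_scalar,
      Matrix.scalar_apply, Matrix.diagonal_mul, Matrix.mul_diagonal]
    rw [Units.val_inv_eq_inv_val]
    field_simp
  -- the value at the torus element
  have hft : f (zpowDiagGL hϖ.ne_zero (fun i => if c i = 0 then (N : ℤ) else 0)) = ϖ ^ (-(N : ℤ)) := by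
    simp only [hfdef]
    rw [← zpowDiagGL_neg, coe_zpowDiagGL, coe_zpowDiagGL, Matrix.diagonal_apply_eq,
      Matrix.diagonal_apply_eq, Pi.neg_apply]
    simp [hi₀, hj₀]
  have h1 : valuation F (f (zpowDiagGL hϖ.ne_zero (fun i => if c i = 0 then (N : ℤ) else 0))) ≤ γ := by
    rw [← hgz, hfz]
    exact hγ _ ⟨g, hg, rfl⟩
  rw [hft, map_zpow₀] at h1
  exact absurd h1 (not_le.2 (hN₀ N hN))

end Unbounded

/-! ### Harish-Chandra's criterion, direction `⇐`: all Jacquet modules vanish ⇒ supercuspidal -/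

section Sufficiency

variable {F : Type*} [Field F] [ValuativeRel F] [TopologicalSpace F] [IsNonarchimedeanLocalField F]
  {n : ℕ} {k : Type*} [Field k] [CharZero k] {V : Type*} [AddCommGroup V] [Module k V]
  (π : Representation k (GL (Fin n) F) V)

/-- **Uniform gap lemma.** If `π` is smooth and all two-block Jacquet modules vanish, then for
`φ ∈ Ṽ` and `v ∈ V` there is one `D` such that `φ (π(k₁ ϖ^a k₂) v) = 0` for all `k₁, k₂ ∈ GL_n(𝒪)`,
all two-block cuts `c` and all `a` with gap `≥ D` across the cut: the `GL_n(𝒪)`-orbits of `φ`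
and `v` are finite (smoothness), and the gap lemma applies to each pair. [folklore] -/
theorem exists_uniform_gap (hπ : π.IsSmooth) {ϖ : F} (hϖ : IsUniformizingElement ϖ)
    (hJ : ∀ c : Fin n → Fin 2, Monotone c → IsProperBlocks c →
      Representation.Coinvariants.ker (Representation.restrictUnipotentGL F c π) = ⊤)
    {φ : Module.Dual k V} (hφ : φ ∈ π.contragredient) (v : V) :
    ∃ D : ℕ, ∀ k₁ ∈ glInt n F, ∀ k₂ ∈ glInt n F, ∀ c : Fin n → Fin 2, Monotone c → IsProperBlocks c →
      ∀ a : Fin n → ℤ, (∀ i j, c i < c j → (D : ℤ) ≤ a i - a j) →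
        φ (π (k₁ * zpowDiagGL hϖ.ne_zero a * k₂) v) = 0 := by
  classical
  set Oφ : Set (Module.Dual k V) := (fun g => π.dual g φ) '' (glInt n F : Set (GL (Fin n) F)) with hOφ
  set Ov : Set V := (fun g => π g v) '' (glInt n F : Set (GL (Fin n) F)) with hOv
  have hOφfin : Oφ.Finite :=
    JacquetLemma.finite_orbit_of_isSmoothVector π.dual (glInt n F) (isCompact_glInt n F) subset_rfl hφ
  have hOvfin : Ov.Finite :=
    JacquetLemma.finite_orbit_of_isSmoothVector π (glInt n F) (isCompact_glInt n F) subset_rfl (hπ v)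
  -- pointwise gaps
  have hgap : ∀ φ' ∈ Oφ, ∀ v' : V, ∀ c : Fin n → Fin 2, Monotone c → IsProperBlocks c →
      ∃ d : ℕ, ∀ a : Fin n → ℤ, (∀ i j, c i < c j → (d : ℤ) ≤ a i - a j) →
        φ' (π (zpowDiagGL hϖ.ne_zero a) v') = 0 := by
    rintro φ' ⟨g, -, rfl⟩ v' c hc hc'
    refine exists_forall_apply_zpowDiagGL_eq_zero π hπ hϖ (π.contragredient.apply_mem_toSubmodule g hφ) ?_
    rw [hJ c hc hc']
    trivial
  -- a total gap function and a uniform bound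
  let dfun : Module.Dual k V → V → (Fin n → Fin 2) → ℕ := fun φ' v' c =>
    if h : φ' ∈ Oφ ∧ Monotone c ∧ IsProperBlocks c then Classical.choose (hgap φ' h.1 v' c h.2.1 h.2.2)
    else 0
  have hdfun : ∀ φ', φ' ∈ Oφ → ∀ (v' : V) (c : Fin n → Fin 2), Monotone c → IsProperBlocks c →
      ∀ a : Fin n → ℤ, (∀ i j, c i < c j → (dfun φ' v' c : ℤ) ≤ a i - a j) →
        φ' (π (zpowDiagGL hϖ.ne_zero a) v') = 0 := by
    intro φ' h₁ v' c hc hc'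
    have h : φ' ∈ Oφ ∧ Monotone c ∧ IsProperBlocks c := ⟨h₁, hc, hc'⟩
    simp only [dfun, dif_pos h]
    exact Classical.choose_spec (hgap φ' h.1 v' c h.2.1 h.2.2)
  obtain ⟨D, hD⟩ : ∃ D : ℕ, ∀ φ' ∈ Oφ, ∀ v' ∈ Ov, ∀ c, dfun φ' v' c ≤ D := by
    have hfin : ((fun x : Module.Dual k V × V × (Fin n → Fin 2) => dfun x.1 x.2.1 x.2.2) ''
        (Oφ ×ˢ Ov ×ˢ Set.univ)).Finite :=
      (hOφfin.prod (hOvfin.prod Set.finite_univ)).image _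
    obtain ⟨D, hD⟩ := hfin.bddAbove
    exact ⟨D, fun φ' hφ' v' hv' c => hD ⟨(φ', v', c), ⟨hφ', hv', Set.mem_univ _⟩, rfl⟩⟩
  refine ⟨D, fun k₁ hk₁ k₂ hk₂ c hc hc' a ha => ?_⟩
  have h1 : φ (π (k₁ * zpowDiagGL hϖ.ne_zero a * k₂) v) =
      (π.dual k₁⁻¹ φ) (π (zpowDiagGL hϖ.ne_zero a) (π k₂ v)) := by
    rw [Representation.dual_apply, inv_inv, Module.Dual.transpose_apply, LinearMap.comp_apply,
      ← Module.End.mul_apply, ← map_mul, ← Module.End.mul_apply, ← map_mul]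
  rw [h1]
  have hφ' : π.dual k₁⁻¹ φ ∈ Oφ := ⟨k₁⁻¹, Subgroup.inv_mem _ hk₁, rfl⟩
  have hv' : π k₂ v ∈ Ov := ⟨k₂, hk₂, rfl⟩
  refine hdfun _ hφ' _ c hc hc' a fun i j hij => le_trans ?_ (ha i j hij)
  exact_mod_cast hD _ hφ' _ hv' c

/-- **Harish-Chandra's criterion, sufficiency** (Harish-Chandra 1970; Casselman 1995, Thm. 5.3.1
with Cor. 5.3.2; Bernstein–Zelevinsky 1976, Thm. 3.21; Bushnell–Henniart 2006, §10.1
Proposition for `GL(2)`): a *smooth* representation `π` of `GL_n(F)` all of whose Jacquet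
modules for the two-block (maximal proper) standard parabolics vanish is supercuspidal — every
smooth matrix coefficient `g ↦ φ(π(g) v)` has compact support modulo the centre.

Proof: by the Cartan decomposition `g = k₁⁻¹ ϖ^a k₂⁻¹` (`a ∈ ℤⁿ` antitone); by the uniform
gap lemma, a non-zero value forces every consecutive gap `a_i - a_{i+1} < D`, so after the central
normalisation `a_n = 0` (a scalar matrix `ϖ^{a_n}`) the exponent `a` lies in a finite box `A`;
hence `supp ⊆ (⋃_{a ∈ A} GL_n(𝒪) ϖ^a GL_n(𝒪)) · Z`, a compact set times the centre.
Irreducibility and admissibility are not needed. [cite: HarishChandra1970, Part I §3 (p. 9) and Part III] -/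
theorem isSupercuspidal_of_forall_coinvariantsKer_eq_top (hπ : π.IsSmooth)
    (hJ : ∀ c : Fin n → Fin 2, Monotone c → IsProperBlocks c →
      Representation.Coinvariants.ker (Representation.restrictUnipotentGL F c π) = ⊤) :
    π.IsSupercuspidal := by
  classical
  cases n with
  | zero => exact π.isSupercuspidal_of_center_eq_top Subgroup.center_eq_top
  | succ N =>
  intro φ hφ v
  obtain ⟨ϖ, hϖ⟩ := exists_isUniformizingElement (F := F)
  obtain ⟨D, hD⟩ := exists_uniform_gap π hπ hϖ hJ hφ v
  -- the finite box of normalised exponents and the compact set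
  set A : Set (Fin (N + 1) → ℤ) := {a | ∀ i, 0 ≤ a i ∧ a i ≤ (N : ℤ) * D} with hA
  have hAfin : A.Finite := by
    refine (Set.Finite.pi fun _ : Fin (N + 1) => Set.finite_Icc (0 : ℤ) (N * D)).subset fun a ha => ?_
    exact Set.mem_univ_pi.2 fun i => ⟨(ha i).1, (ha i).2⟩
  set C : Set (GL (Fin (N + 1)) F) :=
    ⋃ a ∈ A, (glInt (N + 1) F : Set (GL (Fin (N + 1)) F)) * {zpowDiagGL hϖ.ne_zero a} *
      (glInt (N + 1) F : Set (GL (Fin (N + 1)) F)) with hC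
  refine ⟨C, hAfin.isCompact_biUnion fun a _ =>
    ((isCompact_glInt _ F).mul isCompact_singleton).mul (isCompact_glInt _ F), ?_⟩
  intro g hg
  rw [Function.mem_support, Representation.matrixCoeff_apply] at hg
  obtain ⟨k₁, hk₁, k₂, hk₂, a, ha, hcartan⟩ := exists_glInt_mul_mul_eq_zpowDiagGL hϖ g
  have hg_eq : g = k₁⁻¹ * zpowDiagGL hϖ.ne_zero a * k₂⁻¹ := by
    rw [← hcartan]; group
  -- consecutive gaps are `< D`
  have hgaps : ∀ i : Fin N, a (Fin.castSucc i) - a i.succ < D := by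
    intro i
    by_contra hlt
    have hle : (D : ℤ) ≤ a (Fin.castSucc i) - a i.succ := not_lt.1 hlt
    apply hg
    rw [hg_eq]
    exact hD _ (Subgroup.inv_mem _ hk₁) _ (Subgroup.inv_mem _ hk₂)
      (fun j : Fin (N + 1) => if j ≤ Fin.castSucc i then (0 : Fin 2) else 1) (cutAfter_monotone i)
      (isProperBlocks_cutAfter i) a fun j j' hjj' => le_trans hle (sub_le_sub_of_cutAfter_lt i ha hjj')
  -- normalise the last exponent to `0` by a central element
  set z : ℤ := a (Fin.last N) with hz
  set a' : Fin (N + 1) → ℤ := fun i => a i - z with ha'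
  have ha_split : a = a' + fun _ => z := by
    funext i; simp [ha']
  have hsplit : zpowDiagGL hϖ.ne_zero a =
      zpowDiagGL hϖ.ne_zero a' * zpowDiagGL hϖ.ne_zero (fun _ : Fin (N + 1) => z) := by
    rw [← zpowDiagGL_add, ← ha_split]
  have hcentral : zpowDiagGL hϖ.ne_zero (fun _ : Fin (N + 1) => z) ∈
      Subgroup.center (GL (Fin (N + 1)) F) :=
    Subgroup.mem_center_iff.2 fun h => mul_zpowDiagGL_const_comm hϖ.ne_zero z h
  have ha'A : a' ∈ A := by
    have ha'anti : Antitone a' := fun i j hij => sub_le_sub_right (ha hij) z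
    have ha'last : a' (Fin.last N) = 0 := sub_self _
    have ha'gaps : ∀ i : Fin N, a' (Fin.castSucc i) - a' i.succ < D := fun i => by
      simp only [ha']; linarith [hgaps i]
    intro i
    refine ⟨?_, ?_⟩
    · rw [← ha'last]; exact ha'anti (Fin.le_last i)
    · refine le_trans (le_mul_of_gaps_lt ha'last ha'gaps i) ?_
      exact mul_le_mul_of_nonneg_right (by linarith [(i : Fin (N + 1)).isLt]) (Nat.cast_nonneg D)
  -- conclude
  refine Set.mem_mul.2 ⟨k₁⁻¹ * zpowDiagGL hϖ.ne_zero a' * k₂⁻¹, ?_,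
    zpowDiagGL hϖ.ne_zero (fun _ => z), hcentral, ?_⟩
  · rw [hC]
    refine Set.mem_biUnion ha'A ?_
    exact Set.mul_mem_mul (Set.mul_mem_mul (Subgroup.inv_mem _ hk₁) (Set.mem_singleton _))
      (Subgroup.inv_mem _ hk₂)
  · have hcomm := Subgroup.mem_center_iff.1 hcentral k₂⁻¹
    rw [hg_eq, hsplit]
    simp only [mul_assoc, hcomm]

end Sufficiency

/-! ### Harish-Chandra's criterion, direction `⇒`: supercuspidal ⇒ Jacquet modules vanish -/

section Necessity

variable {F : Type*} [Field F] [ValuativeRel F] [TopologicalSpace F] [IsNonarchimedeanLocalField F]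
  {n : ℕ} {k : Type*} [Field k] [CharZero k] {V : Type*} [AddCommGroup V] [Module k V]
  (π : Representation k (GL (Fin n) F) V)

/-- **Harish-Chandra's criterion, necessity** (Harish-Chandra 1970; Casselman 1995, Thm. 5.3.1;
Bernstein–Zelevinsky 1976, Thm. 3.21; Bushnell–Henniart 2006, §10.2 for `GL(2)`): if `π` is a
*smooth* representation of `GL_n(F)` all of whose smooth matrix coefficients are compactly
supported modulo the centre, then the Jacquet module `V / V(U_c)` vanishes for every proper
two-block labelling `c`.

Proof (Haar-free): if `v₀ ∉ V(U_c)`, choose a principal congruence subgroup `K = K_γ` fixing `v₀`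
(`γ < 1`), the projector `e` onto `V^K`, the torus elements `t_N = diag(ϖ^N on c = 0, 1 on c = 1)`,
the (injective) action `T` of `t_1` on the Jacquet module and, by the linear-algebra lemma, a
linear form `μ` on the Jacquet module with `μ(T^N [v₀]) ≠ 0` for infinitely many `N`. The smooth
form `φ = μ ∘ [·] ∘ e` has `φ(π(t_N) v₀) = μ(T^N [v₀])`, because `K = (K ∩ U_c)(K ∩ P_c⁻)` and
`t_N⁻¹ (K ∩ P_c⁻) t_N ⊆ K`; but `t_N ∉ C · Z` for `N` large, contradicting supercuspidality.
Irreducibility and admissibility are not needed. [cite: HarishChandra1970, Part I §3 (p. 9) and Part III] -/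
theorem coinvariantsKer_eq_top_of_isSupercuspidal (hπ : π.IsSmooth) (hsc : π.IsSupercuspidal)
    {c : Fin n → Fin 2} (hc : IsProperBlocks c) :
    Representation.Coinvariants.ker (Representation.restrictUnipotentGL F c π) = ⊤ := by
  classical
  by_contra hne
  obtain ⟨v₀, hv₀⟩ : ∃ v₀, v₀ ∉ Representation.Coinvariants.ker (Representation.restrictUnipotentGL F c π) :=
    not_forall.1 fun h => hne (Submodule.eq_top_iff'.2 h)
  obtain ⟨ϖ, hϖ⟩ := exists_isUniformizingElement (F := F)
  have hϖ0 : ϖ ≠ 0 := hϖ.ne_zero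
  have hvϖ0 : valuation F ϖ ≠ 0 := (Valuation.ne_zero_iff _).2 hϖ0
  obtain ⟨i₀, hi₀⟩ := hc.1 0
  obtain ⟨j₀, hj₀⟩ := hc.1 1
  -- a principal congruence subgroup of level `< 1` fixing `v₀`
  obtain ⟨γ₁, hγ₁⟩ := exists_congruenceGL_subset (n := n) ((hπ v₀).mem_nhds (Subgroup.one_mem _))
  set γ : (ValueGroupWithZero F)ˣ := min γ₁ (Units.mk0 (valuation F ϖ) hvϖ0) with hγdef
  have hγle : (γ : ValueGroupWithZero F) ≤ γ₁ := Units.val_le_val.2 (min_le_left _ _)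
  have hγlt : (γ : ValueGroupWithZero F) < 1 := by
    refine lt_of_le_of_lt (Units.val_le_val.2 (min_le_right γ₁ (Units.mk0 (valuation F ϖ) hvϖ0))) ?_
    rw [Units.val_mk0]
    exact hϖ.valuation_lt_one
  have hKfix : ∀ g ∈ congruenceGL n (γ : ValueGroupWithZero F), π g v₀ = v₀ := fun g hg =>
    (π.mem_stabilizerSubgroup v₀ g).1 (hγ₁ (congruenceGL_mono hγle hg))
  -- the projector onto the `K`-fixed vectors
  obtain ⟨e, -, he₂, he₃⟩ :=
    hπ.exists_fixedPoints_projection (isCompact_congruenceGL (n := n) (γ : ValueGroupWithZero F))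
  -- the torus elements `t N = diag(ϖ^N on the block c = 0, 1 on the block c = 1)`
  set aN : ℕ → Fin n → ℤ := fun N i => if c i = 0 then (N : ℤ) else 0 with haN
  set t : ℕ → GL (Fin n) F := fun N => zpowDiagGL hϖ0 (aN N) with htdef
  have ht_succ : ∀ N, t (N + 1) = t N * t 1 := by
    intro N
    simp only [htdef, ← zpowDiagGL_add]
    congr 1
    funext i
    simp only [haN, Pi.add_apply]
    split_ifs
    · push_cast; ring
    · simp
  have ht_zero : t 0 = 1 := by
    simp only [htdef]
    have : aN 0 = 0 := by funext i; simp [haN]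
    rw [this, zpowDiagGL_zero]
  -- the action of `t 1` on the Jacquet module
  set σ := Representation.toCoinvariants (π.comp (standardParabolicGL F c).subtype)
    (unipotentRadicalP F c) with hσ
  have ht1P : t 1 ∈ standardParabolicGL F c := zpowDiagGL_mem_standardParabolicGL hϖ0 _ c
  set T := σ ⟨t 1, ht1P⟩ with hT
  set q := Representation.Coinvariants.mk (Representation.restrictUnipotentGL F c π) with hq
  have hTq : ∀ (N : ℕ) (x : V), (T ^ N) (q x) = q (π (t N) x) := by
    intro N
    induction N with
    | zero => intro x; simp [ht_zero]
    | succ N ih =>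
      intro x
      rw [pow_succ, Module.End.mul_apply]
      have h1 : T (q x) = q (π (t 1) x) := by
        rw [hT, hq, hσ]
        rfl
      rw [h1, ih, ← Module.End.mul_apply, ← map_mul, ← ht_succ]
  have hTinj : Function.Injective T := (σ.apply_bijective _).1
  have hw₀ : q v₀ ≠ 0 := by
    rwa [Ne, hq, Representation.Coinvariants.mk_eq_zero]
  obtain ⟨μ, hμ⟩ := exists_dual_forall_exists_apply_pow_ne_zero T hTinj hw₀
  -- the smooth linear form `φ = μ ∘ q ∘ e`
  set φ : Module.Dual k V := μ ∘ₗ q ∘ₗ e with hφdef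
  have hφinv : ∀ g ∈ congruenceGL n (γ : ValueGroupWithZero F), π.dual g φ = φ := by
    intro g hg
    ext x
    simp only [hφdef, Representation.dual_apply, Module.Dual.transpose_apply, LinearMap.comp_apply]
    rw [he₃ _ (Subgroup.inv_mem _ hg)]
  have hφmem : φ ∈ π.contragredient :=
    π.dual.isSmoothVector_of_le (isOpen_congruenceGL (Units.ne_zero γ)) fun g hg => by
      rw [Representation.mem_stabilizerSubgroup]
      exact hφinv g hg
  obtain ⟨C, hC, hsupp⟩ := hsc φ hφmem v₀
  obtain ⟨N₀, hN₀⟩ := exists_forall_zpowDiagGL_not_mem_mul_center hϖ hi₀ hj₀ hC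
  obtain ⟨N, hN, hμN⟩ := hμ N₀
  refine hN₀ N hN (hsupp ?_)
  rw [Function.mem_support, Representation.matrixCoeff_apply]
  -- `φ (π (t N) v₀) = μ (T^N (q v₀))`
  suffices h : q (e (π (t N) v₀)) = (T ^ N) (q v₀) by
    change μ (q (e (π (t N) v₀))) ≠ 0
    rwa [h]
  rw [hTq]
  haveI : CompactSpace (congruenceGL n (γ : ValueGroupWithZero F)) :=
    isCompact_iff_compactSpace.mp (isCompact_congruenceGL (γ : ValueGroupWithZero F))
  obtain ⟨L, hL⟩ := hπ.exists_openNormalSubgroup_forall_apply_eq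
    (congruenceGL n (γ : ValueGroupWithZero F)) (π (t N) v₀)
  haveI : Fintype ((congruenceGL n (γ : ValueGroupWithZero F)) ⧸ L.toSubgroup) := Fintype.ofFinite _
  rw [projector_eq_average π e he₂ he₃ L.toSubgroup hL, map_smul, map_sum]
  have hconst : ∀ r : (congruenceGL n (γ : ValueGroupWithZero F)) ⧸ L.toSubgroup,
      q (π ((r.out : congruenceGL n (γ : ValueGroupWithZero F)) : GL (Fin n) F) (π (t N) v₀)) =
        q (π (t N) v₀) := by
    intro r
    obtain ⟨u, hu, p, hp, -, hpK, hkup⟩ :=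
      exists_unipotent_mul_opposite_of_mem_congruenceGL (c := c) hγlt (r.out).2
    have hconj : (t N)⁻¹ * p * t N ∈ congruenceGL n (γ : ValueGroupWithZero F) :=
      conj_mem_congruenceGL_of_mem_opposite hϖ.valuation_le_one hϖ0 N hp hpK
    have h1 : π ((r.out : congruenceGL n (γ : ValueGroupWithZero F)) : GL (Fin n) F) (π (t N) v₀) =
        π u (π (t N) (π ((t N)⁻¹ * p * t N) v₀)) := by
      rw [hkup, ← Module.End.mul_apply, ← map_mul, ← Module.End.mul_apply, ← map_mul,
        ← Module.End.mul_apply, ← map_mul]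
      congr 1
      group
    rw [h1, hKfix _ hconj]
    exact coinvariants_mk_apply_of_mem_unipotentRadicalGL π hu _
  simp only [hconst, Finset.sum_const, Finset.card_univ]
  rw [← Nat.cast_smul_eq_nsmul k, smul_smul, inv_mul_cancel₀ (Nat.cast_ne_zero.2 Fintype.card_ne_zero),
    one_smul]

end Necessity

/-! ### The discharge of `isSupercuspidal_iff_jacquetGL` -/

section Discharge

variable (F : Type*) [Field F] [ValuativeRel F] [TopologicalSpace F] [IsNonarchimedeanLocalField F]
  {n : ℕ} {V : Type*} [AddCommGroup V] [Module ℂ V]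

/-- **Harish-Chandra's criterion for `GL_n(F)`, discharged** (Harish-Chandra 1970, Part I §3 and
Part III (held copy `book:harish-chandrand-harmonic-analysis-reductive-p-adic-groups`, PDF pp. 9,
15 ff.), where the equivalence is obtained for unitary representations modulo "Conjecture III"
(Theorem 8 / Lemma 15, PDF pp. 24, 29); unconditional and in the smooth category:
Casselman 1995, Thm. 5.3.1; Bernstein–Zelevinsky 1976, Thm. 3.21; Renard 2010, VI.2.1;
Bushnell–Henniart 2006, §10.1–10.2 for `n = 2`): an irreducible smooth representation of
`GL_n(F)` is supercuspidal iff all its proper Jacquet modules vanish. Both directions are proved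
here for arbitrary *smooth* `π` (`isSupercuspidal_of_forall_coinvariantsKer_eq_top`,
`coinvariantsKer_eq_top_of_isSupercuspidal`), reducing a general proper standard parabolic to
the maximal one containing it (first-block coarsening). [cite: HarishChandra1970, Part I §3 (p. 9) and Part III] -/
theorem isSupercuspidal_iff_jacquetGL_holds : isSupercuspidal_iff_jacquetGL F (n := n) (V := V) := by
  intro π _ hπ
  constructor
  · intro hsc r c hc hcm
    change Subsingleton (V ⧸ _)
    rw [Submodule.Quotient.subsingleton_iff]
    have h2 := coinvariantsKer_eq_top_of_isSupercuspidal π hπ hsc (isProperBlocks_firstBlock hc)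
    exact eq_top_iff.2 (h2 ▸ coinvariantsKer_mono π (unipotentRadicalGL_firstBlock_le c))
  · intro h
    refine isSupercuspidal_of_forall_coinvariantsKer_eq_top π hπ fun c hcm hc => ?_
    have := h 2 c hc hcm
    change Subsingleton (V ⧸ _) at this
    exact Submodule.Quotient.subsingleton_iff.1 this

end Discharge

end Literature.NumberTheory.Automorphic
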